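import Summits.BirchSwinnertonDyer.Rank1Residual.F1Sign2.ParitySymbolCocycleAtTwoProofsGluedPair

/-!
# Cell `bsd-f1-sign2`, lens `-desc` g14 (MEMO-desc §22.2, §22.3, §22.10, §22.12): PROOFS for `ParitySymbolCocycleAtTwo.lean`, part 2 —
# rows DESC-§22-K, DESC-§22-Z (real half + assembly) and DESC-§22-A (transvection formula over `𝔽₂`) PROVED

Sources (planner -desc g14): `HOME/MEMO-desc-data/g14/lean/GluedPairIdentity.lean` a33a3d2596811eee lines 269–434 (the REAL half:
`cubic_negative_root_unique`, `aeval_real_gmPartner`, `isBranchRealRoot_false_iff`, `gluedPair_inRealKummerImageAtTwo`,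
`gluedPair_realCorrectionBit_eq_zero`) and lines 468–476 (assembly of rows K and Z, here against the TREE rows, helpers qualified);
`HOME/MEMO-desc-data/g14/lean/Transvection.lean` d1332845eae42874 lines 36–162 (`zmod2_eq_of_add_eq_zero`, `zmod2_eq_one_of_ne_zero`,
`Transvection.transvectionRulingFormulaF2_holds`).  Part 1 (`ParitySymbolCocycleAtTwoProofsGluedPair.lean`) carries row U and the finite-place
half.  Closes BY NAME: `gluedPairDiscrepancyIsKummerClassAtTwo_holds : GluedPairDiscrepancyIsKummerClassAtTwo`,
`gluedPairCorrectionBitVanishesAtTwo_holds : GluedPairCorrectionBitVanishesAtTwo`, `transvectionRulingFormulaF2_holds : TransvectionRulingFormulaF2`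
(all in namespace `Summit.BirchSwinnertonDyer.Rank1Residual.F1Sign2`).  Rows L, L∞, C, C∞ of the statement module remain theorems ON PAPER (REF1 §86), not proved here.

TYPER FILING (seat `bsd-f1-sign2-ty` g8): proofs VERBATIM from the planner's file (sha16 asserted by the builder `tools/mk_desc22proofs.py`,
published with the filed text under `HOME/MEMO-ty-data/g8/`); the planner's local copies of the row defs are DELETED — the theorems now prove the
TREE rows of `F1Sign2/ParitySymbolCocycleAtTwo.lean` by name (same namespace discipline as `CongruenceLocalGaugeAtTwoProofs.lean` p619435:
helpers in the planner's sub-namespace, `…F1Sign2.<row>_holds` at the end); docstrings added where the planner had none; nothing else changed.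
REF1-AUDIT §86 (bsd-f1-sign2-ref1 g8, 2026-08-28T09:09:13Z): rows U/K/Z/A «THEOREMS IN THE KERNEL — CLEARED to land WITH PROOFS»; REF1 recompiled
the planner's compatibility certificates `GluedPairIdentity.CompatDraft.lean` bb1da82a9e01754b and `Transvection.CompatDraft.lean` 05e4558dbde9aafe
(proof file byte-identical + the typed rows closed by `exact`) on the farm: rc 0 · 0 warn · 0 sorry, axioms propext, Classical.choice, Quot.sound
(`REF1-data/b86/compat_check1–4.json`, `transv_check1.json`). No `sorry`, no new `def … : Prop`, no `instance`, no `notation`.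

Planner's proof-file docstring for row A (verbatim, -desc g14 `Transvection.lean`):
# Row DESC-§22-A of Sketch-v18 PROVED: the transvection formula over `𝔽₂`

`dim(W₁ ∩ τ_u W₂) = dim(W₁ ∩ W₂) + c`, `τ_u x = x + B(x,u)u`, `c = 1` iff `u ∉ W₁ ∪ W₂` and `u = a + b` (`a ∈ W₁`, `b ∈ W₂`) with `q b ≠ 0`
(MEMO-desc §22.3 Lemma A; planner `-desc` g14).  Proof: with `f = B(·,u)` and `D′ = W₁ ∩ τ_u W₂`, `D = W₁ ∩ W₂`:
(i) `D′ ∩ ker f = D` (uses only `B` alternating and the two `q`-conditions, which put `D` inside `ker f`);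
(ii) rank–nullity for `f|_{D′}`: `dim D′ = dim D + dim f(D′)`, and `f(D′) ≠ 0` iff some `x = τ_u b ∈ W₁` (`b ∈ W₂`) has `B(x,u) = 1`,
i.e. iff `u = a + b` with `a ∈ W₁`, `b ∈ W₂`, `q b = B(u,b) = 1` — which forces `u ∉ W₁ ∪ W₂`.
The hypotheses `q u = 0`, non-degeneracy, the polarisation identity and the half-dimension conditions are not needed.
No `sorry`; axioms standard.
-/

noncomputable section

open scoped Classical

open WeierstrassCurve Polynomial

namespace Summit.BirchSwinnertonDyer.Rank1Residual.F1Sign2.GluedPairIdentity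

/-! ## The real half of DESC-§22-K / DESC-§22-Z: `u` has the EGG sign type of `c_{E′}`

For every ring map `σ : L_E → ℝ`: `σ(u)·σ(ψβ) = (4c·σ c_E′(θ_E))² > 0` and `σ(ψβ)·σ(t) = −64c² < 0` (`t = ψ θ_F`), so `σ u > 0 ⟺ σ t < 0`;
and `σ t` is a real root of `c_{E′}(X) = X³ + 4bX² + 16acX + 64c²`, `c_{E′}(0) = 64c² > 0`: either every `σ t` is negative (`u` totally
positive), or `c_{E′}` has a positive real root, hence (factor it out; the monic quadratic cofactor has negative constant term) exactly ONE
negative real root, which is then the smallest — so `σ u > 0 ⟺ σ t` is the smallest real root of `c_{E′}` (the `false` branch). No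
intermediate-value argument is needed. -/

/-- Pure real algebra: a monic real cubic `x³ + Bx² + Px + Q` with `Q > 0` and a positive root `x₀` has exactly one negative root `r`. -/
lemma cubic_negative_root_unique (B P Q x₀ : ℝ) (hx₀ : 0 < x₀) (hQ : 0 < Q)
    (hroot : x₀ ^ 3 + B * x₀ ^ 2 + P * x₀ + Q = 0) :
    ∃ r : ℝ, r < 0 ∧ r ^ 3 + B * r ^ 2 + P * r + Q = 0 ∧
      ∀ x : ℝ, x ^ 3 + B * x ^ 2 + P * x + Q = 0 → (x < 0 ↔ x = r) := by
  have hq_neg : x₀ ^ 2 + B * x₀ + P < 0 := by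
    by_contra hcon
    push Not at hcon
    have h1 : 0 ≤ x₀ * (x₀ ^ 2 + B * x₀ + P) := mul_nonneg hx₀.le hcon
    have h2 : x₀ * (x₀ ^ 2 + B * x₀ + P) = -Q := by linear_combination hroot
    linarith
  have hdisc : 0 < (x₀ + B) ^ 2 - 4 * (x₀ ^ 2 + B * x₀ + P) := by nlinarith [sq_nonneg (x₀ + B)]
  obtain ⟨s, hs_nonneg, hs2⟩ : ∃ s : ℝ, 0 ≤ s ∧ s ^ 2 = (x₀ + B) ^ 2 - 4 * (x₀ ^ 2 + B * x₀ + P) :=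
    ⟨Real.sqrt _, Real.sqrt_nonneg _, Real.sq_sqrt hdisc.le⟩
  have hfac : ∀ x : ℝ, x ^ 3 + B * x ^ 2 + P * x + Q =
      (x - x₀) * (x - (-(x₀ + B) - s) / 2) * (x - (-(x₀ + B) + s) / 2) := by
    intro x
    linear_combination hroot + ((x - x₀) / 4) * hs2
  have hprod : (-(x₀ + B) - s) / 2 * ((-(x₀ + B) + s) / 2) = x₀ ^ 2 + B * x₀ + P := by
    linear_combination (-1 / 4 : ℝ) * hs2
  have hle : (-(x₀ + B) - s) / 2 ≤ (-(x₀ + B) + s) / 2 := by linarith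
  have hr_neg : (-(x₀ + B) - s) / 2 < 0 := by
    by_contra hcon
    push Not at hcon
    have : 0 ≤ (-(x₀ + B) - s) / 2 * ((-(x₀ + B) + s) / 2) := mul_nonneg hcon (hcon.trans hle)
    linarith
  have hr'_pos : 0 < (-(x₀ + B) + s) / 2 := by
    by_contra hcon
    push Not at hcon
    have : 0 ≤ (-(x₀ + B) - s) / 2 * ((-(x₀ + B) + s) / 2) := by nlinarith
    linarith
  refine ⟨(-(x₀ + B) - s) / 2, hr_neg, ?_, ?_⟩
  · rw [hfac]; ring
  · intro x hx
    rw [hfac] at hx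
    constructor
    · intro hneg
      rcases mul_eq_zero.mp hx with h | h
      · rcases mul_eq_zero.mp h with h | h
        · have hx0 : x = x₀ := sub_eq_zero.mp h
          rw [hx0] at hneg
          exact absurd hneg (not_lt.mpr hx₀.le)
        · exact sub_eq_zero.mp h
      · have hx0 : x = (-(x₀ + B) + s) / 2 := sub_eq_zero.mp h
        rw [hx0] at hneg
        exact absurd hneg (not_lt.mpr hr'_pos.le)
    · intro h'
      rw [h']
      exact hr_neg

/-- `c_{E′}` evaluated at a real number. -/
lemma aeval_real_gmPartner (a b c : ℤ) (x : ℝ) :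
    aeval x (twoDivisionUCubic (gmPartner a b c)) = x ^ 3 + 4 * b * x ^ 2 + 16 * (a * c) * x + 64 * (c : ℝ) ^ 2 := by
  simp only [twoDivisionUCubic, map_add, map_mul, map_pow, aeval_X, aeval_C, gmP_b₂, gmP_b₄, gmP_b₆, eq_ratCast]
  push_cast
  ring

/-- The `false` branch of `IsBranchRealRoot` spelled out. -/
lemma isBranchRealRoot_false_iff (K : Type) [Field K] (σ : K →+* ℝ) (q : ℚ[X]) (e : K) :
    IsBranchRealRoot K σ q e false ↔ ∀ x : ℝ, aeval x q = 0 → σ e ≤ x := by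
  simp [IsBranchRealRoot]

/-- **DESC-§22-K, real place (proved).** For the glued pair with a pinned congruence (both cubics irreducible), `u_{E_f,E′_f}` lies in the
explicit REAL Kummer image of `E′_f` read in `L_E`: `u` is totally positive or has the egg sign type of `c_{E′}`. -/
theorem gluedPair_inRealKummerImageAtTwo (a b c : ℤ) (hc : c ≠ 0)
    (ψ : twoDivisionAlgebra (gmPartner a b c) →ₐ[ℚ] twoDivisionAlgebra (gmCurve a b c))
    (hpin : ψ (twoDivisionRoot (gmPartner a b c)) * twoDivisionRoot (gmCurve a b c) =
      algebraMap ℚ (twoDivisionAlgebra (gmCurve a b c)) (16 * c : ℚ))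
    [Fact (Irreducible (twoDivisionUCubic (gmCurve a b c)))] [Fact (Irreducible (twoDivisionUCubic (gmPartner a b c)))] :
    InRealKummerImageAtTwo (gmCurve a b c) (twoDivisionUCubic (gmPartner a b c)) (ψ (twoDivisionRoot (gmPartner a b c)))
      (thetaDiscrepancyAtTwo (gmCurve a b c) (gmPartner a b c) ψ) := by
  have hcR : (c : ℝ) ≠ 0 := Int.cast_ne_zero.mpr hc
  have hc2 : (0 : ℝ) < (c : ℝ) ^ 2 := lt_of_le_of_ne (sq_nonneg _) (Ne.symm (pow_ne_zero 2 hcR))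
  have hD : twoDivisionDifferent (gmCurve a b c) ≠ 0 := twoDivisionDifferent_ne_zero (gmCurve a b c)
  -- the sign relation, per real place
  have key : ∀ σ : twoDivisionAlgebra (gmCurve a b c) →+* ℝ,
      σ (thetaDiscrepancyAtTwo (gmCurve a b c) (gmPartner a b c) ψ) ≠ 0 ∧ σ (ψ (twoDivisionRoot (gmPartner a b c))) ≠ 0 ∧
      (0 < σ (thetaDiscrepancyAtTwo (gmCurve a b c) (gmPartner a b c) ψ) ↔ σ (ψ (twoDivisionRoot (gmPartner a b c))) < 0) := by
    intro σ
    have hσD : σ (twoDivisionDifferent (gmCurve a b c)) ≠ 0 := (map_ne_zero σ).mpr hD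
    have e1 : σ (thetaDiscrepancyAtTwo (gmCurve a b c) (gmPartner a b c) ψ) * σ (ψ (gmBeta a b c)) =
        (4 * c * σ (twoDivisionDifferent (gmCurve a b c))) ^ 2 := by
      rw [← map_mul, theta_mul_psi_gmBeta_int a b c hc ψ hpin, map_pow, map_mul, map_intCast]
      push_cast
      ring
    have h4cD : 4 * (c : ℝ) * σ (twoDivisionDifferent (gmCurve a b c)) ≠ 0 :=
      mul_ne_zero (mul_ne_zero (by norm_num) hcR) hσD
    have e1pos : 0 < σ (thetaDiscrepancyAtTwo (gmCurve a b c) (gmPartner a b c) ψ) * σ (ψ (gmBeta a b c)) := by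
      rw [e1]
      exact lt_of_le_of_ne (sq_nonneg _) (Ne.symm (pow_ne_zero 2 h4cD))
    have e2 : σ (ψ (gmBeta a b c)) * σ (ψ (twoDivisionRoot (gmPartner a b c))) = -(64 * (c : ℝ) ^ 2) := by
      rw [← map_mul, psi_gmBeta_mul_t_int, map_intCast]
      push_cast
      ring
    have e2neg : σ (ψ (gmBeta a b c)) * σ (ψ (twoDivisionRoot (gmPartner a b c))) < 0 := by
      rw [e2]
      linarith
    rcases mul_pos_iff.mp e1pos with ⟨hu, hb⟩ | ⟨hu, hb⟩
    · rcases mul_neg_iff.mp e2neg with ⟨_, ht⟩ | ⟨hb', _⟩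
      · exact ⟨hu.ne', ht.ne, iff_of_true hu ht⟩
      · exact absurd hb' (not_lt.mpr hb.le)
    · rcases mul_neg_iff.mp e2neg with ⟨hb', _⟩ | ⟨_, ht⟩
      · exact absurd hb' (not_lt.mpr hb.le)
      · exact ⟨hu.ne, ht.ne', iff_of_false (not_lt.mpr hu.le) (not_lt.mpr ht.le)⟩
  -- the root relation, per real place
  have hroot : ∀ σ : twoDivisionAlgebra (gmCurve a b c) →+* ℝ,
      σ (ψ (twoDivisionRoot (gmPartner a b c))) ^ 3 + 4 * b * σ (ψ (twoDivisionRoot (gmPartner a b c))) ^ 2 +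
        16 * (a * c) * σ (ψ (twoDivisionRoot (gmPartner a b c))) + 64 * (c : ℝ) ^ 2 = 0 := by
    intro σ
    have h := congrArg σ (psi_root_relation_int a b c ψ)
    simp only [map_add, map_mul, map_pow, map_intCast, map_zero] at h
    push_cast at h
    linear_combination h
  -- case split: is `u` totally positive?
  by_cases hall : ∀ σ : twoDivisionAlgebra (gmCurve a b c) →+* ℝ, 0 < σ (thetaDiscrepancyAtTwo (gmCurve a b c) (gmPartner a b c) ψ)
  · exact Or.inl hall
  · right
    push Not at hall
    obtain ⟨σ₀, hσ₀⟩ := hall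
    obtain ⟨_, ht0ne, hiff0⟩ := key σ₀
    have ht0 : 0 < σ₀ (ψ (twoDivisionRoot (gmPartner a b c))) := by
      rcases lt_trichotomy (σ₀ (ψ (twoDivisionRoot (gmPartner a b c)))) 0 with h | h | h
      · exact absurd (hiff0.mpr h) (not_lt.mpr hσ₀)
      · exact absurd h ht0ne
      · exact h
    obtain ⟨r, hr_neg, hr_root, hr_iff⟩ :=
      cubic_negative_root_unique (4 * b) (16 * (a * c)) (64 * (c : ℝ) ^ 2) _ ht0 (by linarith) (hroot σ₀)
    intro σ
    obtain ⟨hu, _, hiff⟩ := key σ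
    refine ⟨hu, ?_⟩
    rw [hiff, isBranchRealRoot_false_iff]
    simp only [aeval_real_gmPartner]
    constructor
    · intro hneg x hx
      have hσr : σ (ψ (twoDivisionRoot (gmPartner a b c))) = r := (hr_iff _ (hroot σ)).mp hneg
      rcases lt_or_ge x 0 with hx0 | hx0
      · rw [hσr]
        exact le_of_eq ((hr_iff x hx).mp hx0).symm
      · linarith
    · intro hmin
      have := hmin r hr_root
      linarith

/-- **DESC-§22-Z, real place (proved).** The correction bit of any real local parity symbol of the glued pair is `0`. -/
theorem gluedPair_realCorrectionBit_eq_zero (a b c : ℤ) (hc : c ≠ 0)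
    (ψ : twoDivisionAlgebra (gmPartner a b c) →ₐ[ℚ] twoDivisionAlgebra (gmCurve a b c))
    (hpin : ψ (twoDivisionRoot (gmPartner a b c)) * twoDivisionRoot (gmCurve a b c) =
      algebraMap ℚ (twoDivisionAlgebra (gmCurve a b c)) (16 * c : ℚ))
    [Fact (Irreducible (twoDivisionUCubic (gmCurve a b c)))] [Fact (Irreducible (twoDivisionUCubic (gmPartner a b c)))]
    (d₀ c₀ : ℕ)
    (h : IsLocalParitySymbolAt (gmCurve a b c) ℝ
      (InRealKummerImageAtTwo (gmCurve a b c) (twoDivisionUCubic (gmCurve a b c)) (twoDivisionRoot (gmCurve a b c)))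
      (InRealKummerImageAtTwo (gmCurve a b c) (twoDivisionUCubic (gmPartner a b c)) (ψ (twoDivisionRoot (gmPartner a b c))))
      (thetaDiscrepancyAtTwo (gmCurve a b c) (gmPartner a b c) ψ) d₀ c₀) :
    c₀ = 0 := by
  obtain ⟨_, hc0⟩ := h
  rw [hc0, if_neg]
  exact fun hh => hh.2.1 (gluedPair_inRealKummerImageAtTwo a b c hc ψ hpin)

end Summit.BirchSwinnertonDyer.Rank1Residual.F1Sign2.GluedPairIdentity

namespace Summit.BirchSwinnertonDyer.Rank1Residual.F1Sign2

/-- **DESC-§22-K `GluedPairDiscrepancyIsKummerClassAtTwo` HOLDS** (tree row, closed by name; -desc g14 `GluedPairIdentity.lean` l.468–471):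
`u ∈ ψ_*δ_p(E′_f)` at every prime (part 1) and `u ∈ δ_∞(E′_f)` (real half above). `gmDisc ≠ 0` unused (REF1 §86 r1). -/
theorem gluedPairDiscrepancyIsKummerClassAtTwo_holds : GluedPairDiscrepancyIsKummerClassAtTwo := by
  intro a b c hc _ _ _ ψ hpin
  exact ⟨fun p _ => GluedPairIdentity.gluedPair_inTransportedKummerImageAtTwo a b c hc ψ hpin p,
    GluedPairIdentity.gluedPair_inRealKummerImageAtTwo a b c hc ψ hpin⟩

/-- **DESC-§22-Z `GluedPairCorrectionBitVanishesAtTwo` HOLDS** (tree row, closed by name; -desc g14 `GluedPairIdentity.lean` l.473–476):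
the correction bit of every local parity symbol of the glued pair (`ℚ_p` and `ℝ`) is `0` (= K + the definition of the bit, REF1 §86 r2). -/
theorem gluedPairCorrectionBitVanishesAtTwo_holds : GluedPairCorrectionBitVanishesAtTwo := by
  intro a b c hc _ _ _ ψ hpin
  exact ⟨fun p _ dp cp h => GluedPairIdentity.gluedPair_correctionBit_eq_zero a b c hc ψ hpin p dp cp h,
    fun d₀ c₀ h => GluedPairIdentity.gluedPair_realCorrectionBit_eq_zero a b c hc ψ hpin d₀ c₀ h⟩

end Summit.BirchSwinnertonDyer.Rank1Residual.F1Sign2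

end

/-! ## Row DESC-§22-A: the transvection formula over `𝔽₂` (-desc g14 `Transvection.lean` d1332845eae42874, verbatim) -/

noncomputable section

open scoped Classical

namespace Summit.BirchSwinnertonDyer.Rank1Residual.F1Sign2.Transvection

/-- In `𝔽₂`, `a + b = 0 → a = b`. -/
lemma zmod2_eq_of_add_eq_zero (a b : ZMod 2) (h : a + b = 0) : a = b := by
  revert a b h; decide

/-- In `𝔽₂`, `a ≠ 0 → a = 1`. -/
lemma zmod2_eq_one_of_ne_zero (a : ZMod 2) (h : a ≠ 0) : a = 1 := by
  revert a h; decide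

/-- **Row DESC-§22-A PROVED** (the tree row `F1Sign2.TransvectionRulingFormulaF2`, by name): `dim(W₁ ∩ τ_u W₂) = dim(W₁ ∩ W₂) + c` —
(i) `(W₁ ∩ τ_uW₂) ∩ ker B(·,u) = W₁ ∩ W₂`; (ii) rank–nullity for `B(·,u)` on `W₁ ∩ τ_uW₂`, whose image is non-zero iff `u = a + b`,
`a ∈ W₁`, `b ∈ W₂`, `q b = 1`.  Unused hypotheses: `q u = 0`, non-degeneracy, polarisation, half-dimension (REF1 §86 r4). -/
theorem transvectionRulingFormulaF2_holds : TransvectionRulingFormulaF2 := by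
  intro V _ _ _ B q hAlt _hNd _hq W₁ W₂ u _hqu hW₁ hW₂ _h1 _h2 c hc
  -- notation
  set τ : V →ₗ[ZMod 2] V := LinearMap.id + (B.flip u).smulRight u with hτdef
  set f : V →ₗ[ZMod 2] ZMod 2 := B.flip u with hfdef
  have hf : ∀ x, f x = B x u := fun x => by simp [hfdef, LinearMap.flip_apply]
  have hτ : ∀ x, τ x = x + (B x u) • u := fun x => by
    simp [hτdef, LinearMap.add_apply, LinearMap.smulRight_apply, hf]
  -- characteristic-two bookkeeping in `V`
  have hvv : ∀ v : V, v + v = 0 := fun v => by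
    rw [← two_smul (ZMod 2) v, show (2 : ZMod 2) = 0 from rfl, zero_smul]
  have hsolve : ∀ x y : V, x = y + u → u = x + y := fun x y h => by
    rw [h, add_comm y u, add_assoc, hvv, add_zero]
  -- `B` is symmetric (alternating in characteristic two)
  have hsym : ∀ x y, B x y = B y x := by
    intro x y
    have h := hAlt (x + y)
    simp only [map_add, LinearMap.add_apply, hAlt, zero_add, add_zero] at h
    rw [add_comm] at h
    exact zmod2_eq_of_add_eq_zero _ _ h
  -- `B(τ y, u) = B(y, u)`
  have hBτ : ∀ y, B (τ y) u = B y u := fun y => by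
    rw [hτ, map_add, LinearMap.add_apply, map_smul, LinearMap.smul_apply, hAlt u, smul_zero, add_zero]
  -- `D = W₁ ⊓ W₂` lies in `ker f`
  have hDker : ∀ x, x ∈ W₁ → x ∈ W₂ → B x u = 0 := by
    intro x hx1 hx2
    have h1 := hW₁ x hx1
    have h2 := hW₂ x hx2
    rw [h1, zero_add] at h2
    rw [hsym]; exact h2
  -- membership in `D′ = W₁ ⊓ τ W₂`
  have hmemD' : ∀ x, x ∈ W₁ ⊓ W₂.map τ ↔ x ∈ W₁ ∧ ∃ y ∈ W₂, τ y = x := by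
    intro x; simp [Submodule.mem_inf, Submodule.mem_map]
  -- (i) `D′ ∩ ker f = D`, both inclusions elementwise
  have hD'ker : ∀ x, x ∈ W₁ ⊓ W₂.map τ → B x u = 0 → x ∈ W₁ ⊓ W₂ := by
    intro x hx hfx
    obtain ⟨hx1, y, hy2, hyx⟩ := (hmemD' x).mp hx
    have hBy : B y u = 0 := by rw [← hBτ, hyx]; exact hfx
    have hxy : x = y := by rw [← hyx, hτ, hBy, zero_smul, add_zero]
    exact Submodule.mem_inf.mpr ⟨hx1, hxy ▸ hy2⟩
  have hDD' : ∀ x, x ∈ W₁ ⊓ W₂ → x ∈ W₁ ⊓ W₂.map τ := by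
    intro x hx
    obtain ⟨hx1, hx2⟩ := Submodule.mem_inf.mp hx
    refine (hmemD' x).mpr ⟨hx1, x, hx2, ?_⟩
    rw [hτ, hDker x hx1 hx2, zero_smul, add_zero]
  -- the restriction `g = f|_{D′}`
  set D' : Submodule (ZMod 2) V := W₁ ⊓ W₂.map τ with hD'def
  let g : D' →ₗ[ZMod 2] ZMod 2 := f.comp D'.subtype
  have hg : ∀ x : D', g x = B (x : V) u := fun x => by simp [g, hf]
  -- ker g ≃ D
  have hle : W₁ ⊓ W₂ ≤ D' := fun x hx => hDD' x hx
  have hkerg : LinearMap.ker g = (W₁ ⊓ W₂).comap D'.subtype := by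
    ext x
    simp only [LinearMap.mem_ker, Submodule.mem_comap, Submodule.subtype_apply, hg]
    constructor
    · intro h0; exact hD'ker x x.2 h0
    · intro hx; obtain ⟨hx1, hx2⟩ := Submodule.mem_inf.mp hx; exact hDker x hx1 hx2
  have hfinker : Module.finrank (ZMod 2) (LinearMap.ker g) = Module.finrank (ZMod 2) ↥(W₁ ⊓ W₂) := by
    rw [hkerg]; exact (Submodule.comapSubtypeEquivOfLe hle).finrank_eq
  -- rank–nullity
  have hrn := LinearMap.finrank_range_add_finrank_ker g
  -- the condition `P`
  set P : Prop := (u ∉ W₁ ∧ u ∉ W₂ ∧ ∃ a ∈ W₁, ∃ b ∈ W₂, u = a + b ∧ q b ≠ 0) with hPdef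
  -- `P ↔ g ≠ 0`
  have hPiff : P ↔ ∃ x : D', g x ≠ 0 := by
    constructor
    · rintro ⟨-, -, a, ha, b, hb, hab, hqb⟩
      have hBub : B b u = q b := by
        have h2 := hW₂ b hb
        rw [hsym]; exact (zmod2_eq_of_add_eq_zero _ _ h2).symm
      have hfb : B b u = 1 := by rw [hBub]; exact zmod2_eq_one_of_ne_zero _ hqb
      have hτb : τ b = a := by
        rw [hτ, hfb, one_smul, hab, add_comm a b, ← add_assoc, hvv, zero_add]
      have haD' : a ∈ D' := (hmemD' a).mpr ⟨ha, b, hb, hτb⟩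
      refine ⟨⟨a, haD'⟩, ?_⟩
      rw [hg]; change B a u ≠ 0
      rw [← hτb, hBτ, hfb]; exact one_ne_zero
    · rintro ⟨x, hx⟩
      rw [hg] at hx
      obtain ⟨hx1, y, hy2, hyx⟩ := (hmemD' x).mp x.2
      have hBy : B y u = 1 := by rw [← hBτ, hyx]; exact zmod2_eq_one_of_ne_zero _ hx
      have hxyu : (x : V) = y + u := by rw [← hyx, hτ, hBy, one_smul]
      have hu : u = x + y := hsolve _ _ hxyu
      have hqy : q y ≠ 0 := by
        have h2 := hW₂ y hy2
        have : q y = B u y := zmod2_eq_of_add_eq_zero _ _ h2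
        rw [this, hsym, hBy]; exact one_ne_zero
      refine ⟨?_, ?_, x, hx1, y, hy2, hu, hqy⟩
      · intro hu1
        -- then y = x + u ∈ W₁, so y ∈ D ⊆ ker f, contradicting B y u = 1
        have hy1 : y ∈ W₁ := by
          have : y = x + u := by rw [hxyu, add_assoc, hvv, add_zero]
          rw [this]; exact W₁.add_mem hx1 hu1
        have := hDker y hy1 hy2
        rw [hBy] at this; exact one_ne_zero this
      · intro hu2
        have hx2 : (x : V) ∈ W₂ := by rw [hxyu]; exact W₂.add_mem hy2 hu2
        have := hDker x hx1 hx2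
        exact hx this
  -- finrank of the range
  have hrange : Module.finrank (ZMod 2) (LinearMap.range g) = if P then 1 else 0 := by
    by_cases hP : P
    · rw [if_pos hP]
      obtain ⟨x, hx⟩ := hPiff.mp hP
      have hgx : g x = 1 := zmod2_eq_one_of_ne_zero _ hx
      have htop : LinearMap.range g = ⊤ := by
        rw [LinearMap.range_eq_top]
        intro t
        refine ⟨t • x, ?_⟩
        rw [map_smul, hgx, smul_eq_mul, mul_one]
      rw [htop, finrank_top, Module.finrank_self]
    · rw [if_neg hP]
      have hbot : LinearMap.range g = ⊥ := by
        rw [LinearMap.range_eq_bot]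
        ext x
        by_contra hx
        exact hP (hPiff.mpr ⟨x, hx⟩)
      rw [hbot, finrank_bot]
  -- assemble
  rw [hc, ← hrange, ← hfinker]
  omega

end Summit.BirchSwinnertonDyer.Rank1Residual.F1Sign2.Transvection

namespace Summit.BirchSwinnertonDyer.Rank1Residual.F1Sign2

/-- **DESC-§22-A `TransvectionRulingFormulaF2` HOLDS** (tree row, closed by name; proof -desc g14, REF1 §86 «theorem in the kernel»;
Lemma A of MEMO-desc §22.3 verified exhaustively by REF1 for `n ≤ 3`, 36 036 configurations). -/
theorem transvectionRulingFormulaF2_holds : TransvectionRulingFormulaF2 :=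
  Transvection.transvectionRulingFormulaF2_holds

end Summit.BirchSwinnertonDyer.Rank1Residual.F1Sign2

end
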